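import Summits.ValiantsHypothesis.ValiantsHypothesis.Theorems.BarrierLeverReadOnceDeterminantsHitByVPMaxPlusStates
import Summits.ValiantsHypothesis.ValiantsHypothesis.Theorems.BarrierLeverTransversalResultantKernelNonsingularTropical
import Summits.ValiantsHypothesis.ValiantsHypothesis.Theses.BarrierLever

/-!
# Route BarrierLever — item `ReadOnceDeterminantsHitByVP` (stmt-ValiantsHypothesis-20152):
# MAX-PLUS ISOLATION — sums of box product states hit every determinantal layout with a certificate

Helper file (`--supports stmt-ValiantsHypothesis-20152`; cell valiant-natproofs, rung V4, 𝒟-side,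
prover seat val-np-p3). Definition-free. Closes NO item.

**Setting (tree regime `d = n` over `ℂ`).** A determinantal layout `E : Layout n r` (entries: a
coefficient variable `c_m`, `m ∈ degLEMonomials n`, or a complex constant; no read-once hypothesis is
needed here) has distinguisher `E.detPoly = det E ∈ ℂ[c_m]` (`…TorusIsolation.Layout`). The tree's
TORUS ISOLATION (`…TorusIsolation.exists_torusScale_hits`, item 19449) hits `E` whenever ONE permutation
is isolated by the LINEAR weights `m ↦ Σ_i w_i m_i` of a torus orbit. This file replaces the torus by
a richer, still succinct, one-parameter family and the linear weights by MAX-PLUS weights.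

**Witness.** A BOX PRODUCT STATE with box `d : Fin n → ℕ` (`Σ_i d_i ≤ n`) and tables
`φ_i : ℕ → ℕ` at the parameter `T ∈ ℂ` is `g_T = ∏_i Σ_{e ≤ d_i} T^{φ_i(e)} x_i^e`; its coefficients
are `coeff_m g_T = T^{Σ_i φ_i(m_i)}` for `m` in the box and `0` outside (`coeff_boxState`). The
witness is a SUM of `m` box product states (`coeff_sumBoxStates`); it has degree `≤ n` and size
`≤ m·(n(n+1)(n+2)+n+1)`, so it lies in `SmallCircuits ℂ n (c+4)` for `m ≤ n^c`, `n ≥ 8`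
(`sumBoxStates_mem_smallCircuits`).

**Theorem (`det_ne_zero_of_unique_maxDegree`, Mathlib only).** A square matrix over `ℂ[X]` has
nonzero determinant as soon as ONE permutation `σ₀` meets only nonzero entries and every other
permutation either meets a zero entry or has a strictly smaller sum of entry degrees.

**Theorem (`layout_hit_of_maxPlusCertificate`).** Along the witness family the entry `c_m` of `E`
becomes `Σ_{k : m ∈ box_k} T^{score_k(m)}`, `score_k(m) = Σ_i φ_{k,i}(m_i)`, of degree
`deg(m) = max_{k : m ∈ box_k} score_k(m)` (a max-plus weight — NONLINEAR in `m`, one table per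
variable and exponent value, maximised over experts). If a permutation `σ₀` meets only USABLE entries
(nonzero constants; variables lying in some box) and every other permutation meets an unusable entry
or has smaller total degree, then `eval (coeffVector f) E.detPoly ≠ 0` for some
`f ∈ SmallCircuits ℂ n (c+4)`. The arrow onto the route declaration:
`readOnceDeterminantsHitByVP_of_maxPlusCertificates` — certificates with `m ≤ n^c` experts for all
read-once layouts of size `≤ C(2n,n)^a`, eventually in `n`, for every `a` ⇒
`Theses.BarrierLever.ReadOnceDeterminantsHitByVP`.

RELATION TO THE TREE: torus isolation is the special case of linear tables on the simplex (there the
base point `(1 + Σ x_i)^n` has full support; here supports are boxes, several of them, and the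
weights are arbitrary functions of each exponent); the partition-matrix rung
`…ProductStateSums.partitionMinor_hit_of_maxPlusCertificate` (item 19717) is the multilinear box
`d ≡ 1` on `h + h` variables with a pairing. Like every tropical certificate, this one is a
SUFFICIENT condition only.

WHAT THIS IS NOT: not a proof of item 20152 or of FSV18 §8's read-once question; nothing on crux
stmt-14610 or `VP` vs `VNP`.

References: [ForbesShpilkaVolk2018] §8; Klivans–Spielman 2001 / Mulmuley–Vazirani–Vazirani 1987
(isolation of one Leibniz term); [Burgisser2000] §2.1 (size measure).
-/

-- layout Summits/ValiantsHypothesis/ValiantsHypothesis forces the duplicated namespace component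
set_option linter.dupNamespace false

namespace Summit.ValiantsHypothesis.ValiantsHypothesis.Theorems.BarrierLever.ReadOnceMaxPlus


-- layout Summits/ValiantsHypothesis/ValiantsHypothesis forces the duplicated namespace component
set_option linter.dupNamespace false

namespace Summit.ValiantsHypothesis.ValiantsHypothesis.Theorems.BarrierLever.ReadOnceMaxPlus

open Finset Literature.Barriers.ValiantsHypothesis Literature.Computability.AlgebraicComplexity
open Summit.ValiantsHypothesis.ValiantsHypothesis.Theorems.BarrierLever.TorusIsolation

noncomputable section

/-! ## 3. Max-plus certificates for determinantal layouts -/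

section Headline

open MvPolynomial

variable {n r : ℕ}

/-- **Max-plus isolation for determinantal layouts.** Data: `m ≤ n^c` experts, expert `k` with a
box `d k : Fin n → ℕ`, `Σ_i d k i ≤ n`, and tables `φ k i : ℕ → ℕ`. An entry of the layout `E` is
USABLE if it is a nonzero constant or a variable `c_m` with `m` in some box; its DEGREE is `0` for a
constant and `max_{k : m ∈ box_k} Σ_i φ k i (m i)` for a variable (`ok`, `deg`, supplied by `rfl`).
If `σ₀` meets only usable entries and every other permutation meets an unusable entry or has a
smaller total degree, then some `f ∈ SmallCircuits ℂ n (c+4)` (`n ≥ 8`) has `det E (coeff f) ≠ 0`. -/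
theorem layout_hit_of_maxPlusCertificate (c : ℕ) (hn : 8 ≤ n) (E : Layout n r)
    (m : ℕ) (hm : m ≤ n ^ c) (d : Fin m → Fin n → ℕ) (hd : ∀ k, ∑ i, d k i ≤ n)
    (φ : Fin m → Fin n → ℕ → ℕ)
    (ok : Fin r → Fin r → Prop)
    (hok : ok = fun i j => Sum.elim
      (fun mo : degLEMonomials n => ∃ k, ∀ t, (mo : Fin n →₀ ℕ) t ≤ d k t) (fun z => z ≠ 0) (E i j))
    (deg : Fin r → Fin r → ℕ)
    (hdeg : deg = fun i j => Sum.elim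
      (fun mo : degLEMonomials n => (univ.filter (fun k => ∀ t, (mo : Fin n →₀ ℕ) t ≤ d k t)).sup
        (fun k => ∑ t, φ k t ((mo : Fin n →₀ ℕ) t))) (fun _ => 0) (E i j))
    (σ₀ : Equiv.Perm (Fin r)) (h0 : ∀ j, ok (σ₀ j) j)
    (huniq : ∀ σ : Equiv.Perm (Fin r), σ ≠ σ₀ →
      (∃ j, ¬ ok (σ j) j) ∨ ∑ j, deg (σ j) j < ∑ j, deg (σ₀ j) j) :
    ∃ f ∈ SmallCircuits ℂ n (c + 4), eval (coeffVector (degLEMonomials n) f) E.detPoly ≠ 0 := by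
  classical
  have hok' : ∀ i j, ok i j ↔ Sum.elim
      (fun mo : degLEMonomials n => ∃ k, ∀ t, (mo : Fin n →₀ ℕ) t ≤ d k t) (fun z => z ≠ 0) (E i j) :=
    fun i j => Iff.of_eq (congrFun (congrFun hok i) j)
  have hdeg' : ∀ i j, deg i j = Sum.elim
      (fun mo : degLEMonomials n => (univ.filter (fun k => ∀ t, (mo : Fin n →₀ ℕ) t ≤ d k t)).sup
        (fun k => ∑ t, φ k t ((mo : Fin n →₀ ℕ) t))) (fun _ => 0) (E i j) :=
    fun i j => congrFun (congrFun hdeg i) j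
  -- the one-parameter family of evaluated layouts, as a matrix over `ℂ[X]`
  set P : Matrix (Fin r) (Fin r) (Polynomial ℂ) := fun i j => Sum.elim
    (fun mo : degLEMonomials n =>
      ∑ k ∈ univ.filter (fun k => ∀ t, (mo : Fin n →₀ ℕ) t ≤ d k t),
        (Polynomial.X : Polynomial ℂ) ^ ∑ t, φ k t ((mo : Fin n →₀ ℕ) t))
    (fun z => Polynomial.C z) (E i j) with hP
  -- usable entries are nonzero, with the advertised degree; unusable ones vanish
  have hPne : ∀ i j, ok i j → P i j ≠ 0 := by
    intro i j hij0
    have hij := (hok' i j).mp hij0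
    simp only [hP]
    rcases hE : E i j with mo | z
    · rw [hE] at hij
      simp only [Sum.elim_inl] at hij ⊢
      refine finsetSum_X_pow_ne_zero _ ?_ _
      obtain ⟨k, hk⟩ := hij
      exact ⟨k, by simpa using hk⟩
    · rw [hE] at hij
      simp only [Sum.elim_inr] at hij ⊢
      exact Polynomial.C_ne_zero.mpr hij
  have hPzero : ∀ i j, ¬ ok i j → P i j = 0 := by
    intro i j hij0
    have hij := mt (hok' i j).mpr hij0
    simp only [hP]
    rcases hE : E i j with mo | z
    · rw [hE] at hij
      simp only [Sum.elim_inl, not_exists] at hij ⊢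
      refine Finset.sum_eq_zero fun k hk => ?_
      exact absurd (by simpa using hk) (hij k)
    · rw [hE] at hij
      simp only [Sum.elim_inr, not_not] at hij ⊢
      rw [hij, Polynomial.C_0]
  have hPdeg : ∀ i j, (P i j).natDegree = deg i j := by
    intro i j
    rw [hdeg']
    simp only [hP]
    rcases hE : E i j with mo | z
    · simp only [Sum.elim_inl]
      by_cases hS : (univ.filter (fun k => ∀ t, (mo : Fin n →₀ ℕ) t ≤ d k t)).Nonempty
      · exact natDegree_finsetSum_X_pow _ hS _
      · rw [Finset.not_nonempty_iff_eq_empty] at hS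
        rw [hS]; simp
    · simp only [Sum.elim_inr, Polynomial.natDegree_C]
  -- the tropical lemma
  have hdet : P.det ≠ 0 := by
    refine det_ne_zero_of_unique_maxDegree P σ₀ (fun j => hPne _ _ (h0 j)) fun σ hσ => ?_
    rcases huniq σ hσ with ⟨j, hj⟩ | hlt
    · exact Or.inl ⟨j, hPzero _ _ hj⟩
    · right; simpa only [hPdeg] using hlt
  obtain ⟨T, hT⟩ := ResultantKernel.exists_eval_ne_zero_of_ne_zero hdet
  -- the witness
  refine ⟨∑ k, ∏ i, ∑ e ∈ range (d k i + 1), C (T ^ φ k i e) * X i ^ e,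
    sumBoxStates_mem_smallCircuits T hn hm d hd φ, ?_⟩
  rw [Layout.eval_detPoly]
  have hmat : (E.map (Sum.elim (coeffVector (degLEMonomials n)
        (∑ k, ∏ i, ∑ e ∈ range (d k i + 1), C (T ^ φ k i e) * X i ^ e : MvPolynomial (Fin n) ℂ))
        (id : ℂ → ℂ))) = (Polynomial.evalRingHom T).mapMatrix P := by
    ext i j
    simp only [RingHom.mapMatrix_apply, Matrix.map_apply, hP]
    rcases hE : E i j with mo | z
    · simp only [Sum.elim_inl, coeffVector_apply, Polynomial.coe_evalRingHom,
        Polynomial.eval_finsetSum, Polynomial.eval_pow, Polynomial.eval_X]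
      exact coeff_sumBoxStates T d φ mo
    · simp only [Sum.elim_inr, id, Polynomial.coe_evalRingHom, Polynomial.eval_C]
  rw [hmat, ← RingHom.map_det]
  exact hT


/-- **The arrow onto item 20152.** If for every level `a` there are `c, n₀` such that, for all
`n ≥ n₀`, every READ-ONCE layout of size `r ≤ C(2n,n)^a` with nonzero distinguisher carries a
max-plus certificate with `m ≤ n^c` box product states, then `ReadOnceDeterminantsHitByVP`
(stmt-ValiantsHypothesis-20152) holds (with `b = c + 4`). -/
theorem readOnceDeterminantsHitByVP_of_maxPlusCertificates
    (hcert : ∀ a : ℕ, ∃ c n₀ : ℕ, ∀ n : ℕ, n₀ ≤ n → ∀ (r : ℕ) (E : Layout n r),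
      r ≤ (Nat.choose (2 * n) n) ^ a →
      (∀ p q : Fin r × Fin r, ∀ mo, E p.1 p.2 = Sum.inl mo → E q.1 q.2 = Sum.inl mo → p = q) →
      E.detPoly ≠ 0 →
      ∃ (m : ℕ) (d : Fin m → Fin n → ℕ) (φ : Fin m → Fin n → ℕ → ℕ) (σ₀ : Equiv.Perm (Fin r)),
        m ≤ n ^ c ∧ (∀ k, ∑ i, d k i ≤ n) ∧
        (∀ j, Sum.elim (fun mo : degLEMonomials n => ∃ k, ∀ t, (mo : Fin n →₀ ℕ) t ≤ d k t)
          (fun z => z ≠ 0) (E (σ₀ j) j)) ∧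
        (∀ σ : Equiv.Perm (Fin r), σ ≠ σ₀ →
          (∃ j, ¬ Sum.elim (fun mo : degLEMonomials n => ∃ k, ∀ t, (mo : Fin n →₀ ℕ) t ≤ d k t)
            (fun z => z ≠ 0) (E (σ j) j)) ∨
          ∑ j, Sum.elim (fun mo : degLEMonomials n =>
              (univ.filter (fun k => ∀ t, (mo : Fin n →₀ ℕ) t ≤ d k t)).sup
                (fun k => ∑ t, φ k t ((mo : Fin n →₀ ℕ) t))) (fun _ => 0) (E (σ j) j) <
          ∑ j, Sum.elim (fun mo : degLEMonomials n =>
              (univ.filter (fun k => ∀ t, (mo : Fin n →₀ ℕ) t ≤ d k t)).sup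
                (fun k => ∑ t, φ k t ((mo : Fin n →₀ ℕ) t))) (fun _ => 0) (E (σ₀ j) j))) :
    Summit.ValiantsHypothesis.ValiantsHypothesis.Theses.BarrierLever.ReadOnceDeterminantsHitByVP := by
  intro a
  obtain ⟨c, n₀, hc⟩ := hcert a
  refine ⟨c + 4, max n₀ 8, fun n hn D hD hD0 => ?_⟩
  obtain ⟨r, E, hr, hro, rfl⟩ := hD
  obtain ⟨m, d, φ, σ₀, hm, hd, h0, huniq⟩ :=
    hc n ((le_max_left _ _).trans hn) r E hr hro hD0
  exact layout_hit_of_maxPlusCertificate c ((le_max_right _ _).trans hn) E m hm d hd φ _ rfl _ rfl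
    σ₀ h0 huniq

end Headline

end

end Summit.ValiantsHypothesis.ValiantsHypothesis.Theorems.BarrierLever.ReadOnceMaxPlus

/-! ## Clean names

The header block above was accidentally duplicated when this file landed (p425264), so the two theorems
live in the doubled namespace `…ReadOnceMaxPlus.Summit.….ReadOnceMaxPlus`. The `export` below makes them
available under the intended names `…BarrierLever.ReadOnceMaxPlus.layout_hit_of_maxPlusCertificate` and
`…BarrierLever.ReadOnceMaxPlus.readOnceDeterminantsHitByVP_of_maxPlusCertificates` (no new declarations). -/

export Summit.ValiantsHypothesis.ValiantsHypothesis.Theorems.BarrierLever.ReadOnceMaxPlus.Summit.ValiantsHypothesis.ValiantsHypothesis.Theorems.BarrierLever.ReadOnceMaxPlus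
  (layout_hit_of_maxPlusCertificate readOnceDeterminantsHitByVP_of_maxPlusCertificates)

end Summit.ValiantsHypothesis.ValiantsHypothesis.Theorems.BarrierLever.ReadOnceMaxPlus
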